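import Summits.BirchSwinnertonDyer.BirchSwinnertonDyer.Theses.AlignedTransportAtTwo
import Summits.BirchSwinnertonDyer.BirchSwinnertonDyer.Theorems.AlignedTransportAtTwoBSDOfMainConjectureRankOneAtTwoOrderTransfer
import Summits.BirchSwinnertonDyer.BirchSwinnertonDyer.Theorems.AlignedTransportAtTwoBSDOfMainConjectureRankOneAtTwoLeadingTermFinal
import Summits.BirchSwinnertonDyer.BirchSwinnertonDyer.Theorems.AlignedTransportAtTwoBSDOfMainConjectureRankOneAtTwoDisegni
import Summits.BirchSwinnertonDyer.BirchSwinnertonDyer.Theorems.AlignedTransportAtTwoBSDOfMainConjectureRankOneAtTwoSigmaSqTwoExistence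
import Literature.NumberTheory.EllipticCurves.PAdicBSDGoodOrdinaryRankOne
import Summits.BirchSwinnertonDyer.Rank1Residual.F1Sign2.SchneiderLeadingTermFormulaAtTwoSq
import HarnessLib

/-! # Line `birth` v6 (attach seat `bsd-line-att-p3` g10 for the lead lineage `bsd-line-att-p1`; v5 = att-p3 g7, v4 = lead att-p1 g4) — crux
`Summit.BirchSwinnertonDyer.BirchSwinnertonDyer.Theses.AlignedTransportAtTwo.BSDOfMainConjectureRankOneAtTwo`
(stmt-BirchSwinnertonDyer-23008, C3′ of route `route-BirchSwinnertonDyer-AlignedTransportAtTwo`).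

**v6 = v5 with the PRINT stub `stub_sigmaSqTwo` CLOSED BY NAME and nothing else changed:** att-p3 g8/g9 DISCHARGED the named fact
`Literature.NumberTheory.EllipticCurves.mazurTate_sigmaSq_existsUnique_two` (Mazur–Tate 1991 Thm. 3.1 at `p = 2` / Silverman 2005 §5 Rem. 2; for every
globally minimal `W/ℚ` with good ORDINARY reduction at `2` there is exactly one `Σ ∈ z² + z³ℤ₂⟦z⟧` satisfying all squared `n`-division identities) —
`…Theorems.AlignedTransportAtTwoSigmaSqTwo.mazurTate_sigmaSq_existsUnique_two_holds` (p644698 ACCEPTED, `--supports 23008`, std axioms; 26 helper files,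
Blakestad–Grant at `p = 2` squared: universal `a₁`-chart ring `R̂₂`, canonical subgroup with `z(Q) = 2`, Frobenius model, `2`-adic contraction constant,
squared `2`-isogeny functional equation, Dwork's lemma, specialisation) — so the `sorry` count drops 5 → 4 and the `Σ²` height receptacle
`IsCanonicalSq` is inhabited UNCONDITIONALLY (`…Theorems.AlignedTransportAtTwoSigmaSqTwoDischarge.existsUnique_isCanonicalSq_two_holds`). The crux now
reads: THREE published facts (M modularity, GZK, Disegni 2020 Thm. 1) + ONE statement not in print at `2` (`stub_leadingTermFormulaAtTwo :
F1Sign2.SchneiderLeadingTermFormulaAtTwoSq`), all by name; the hMT-free closures and the crux-level equivalence «C3′ ⟺ that formula on the cell under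
`MC(W,2)`» modulo the three facts are `…Theorems.AlignedTransportAtTwoSigmaSqTwoDischarge.bsdOfMainConjectureRankOneAtTwo_of_formula_of_disegni` /
`…_iff_formulaOnCell`. The composition below is UNCHANGED (v5's term, with `stub_sigmaSqTwo` now a closed theorem). Lead's verdict unchanged:
«blocked-on: F1Sign2.SchneiderLeadingTermFormulaAtTwoSq»; att-p4 g7's v7 re-pointing at the `Ш`-free kernel-index statement
(`Lines/birth_v7_kerindex_proposal_att_p4g7.lean`, + PRINT stub Prop. 4.14) remains the lead's call. BSD is not proved by any of this.

v5 (kept verbatim below this paragraph): **v5 = v4 with the ONE open stub BY NAME and nothing else changed:** `stub_leadingTermFormulaAtTwo :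
Summit.BirchSwinnertonDyer.Rank1Residual.F1Sign2.SchneiderLeadingTermFormulaAtTwoSq` — the tree declaration filed by the INPUTS typer
`bsd-inputs-sq-ty1` (p612167, `Summits/BirchSwinnertonDyer/Rank1Residual/F1Sign2/SchneiderLeadingTermFormulaAtTwoSq.lean`, `@[conjecture]`,
body token-identical to v4's inline stub = hypothesis `ha3` of the composition below), as v4's docstring asked («typer asked to file it by
name»; -ty g7 07:54Z: «v5's `stub_leadingTermFormulaAtTwo` should import that module»). The composition elaborates unchanged (the named `def`
unfolds to the inline body). Effect: the crux's single non-PRINT obligation is now ONE NAMED tree object (disprovers / typers / REF2 cite it by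
name; any proof or refutation of `SchneiderLeadingTermFormulaAtTwoSq` closes or kills this stub by `exact`). Stub set, classes and tightness
(p611969) are exactly those of v4. BSD is not proved by any of this.

History: planner v3 (O order transfer + L leading term) → att-p3 g0 reshape (M PRINT / O CLOSED p591537 / L OPEN) → v2 (lead att-p1 g2): stub L SPLIT
BY NAME into L0 = GZK (`stub_gzkAtTwo`, PRINT) + the Mazur–Tate `Σ²` height receptacle (`stub_sigmaSqTwo`, PRINT) · L1 = `stub_schneiderAtTwo :
F1Sign2.SchneiderLeadingTermAtTwoSq` (OPEN at 2) · L2 = `stub_perrinRiouAtTwo : F1Sign2.PerrinRiouComparisonAtTwo` (OPEN at 2) · L3 = landed algebra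
(p594193/p594549/p595308/p598696) → **THIS v3 (lead att-p1 g4): stub L2 LEAVES THE LINE — `PerrinRiouComparisonAtTwo` is now a tree THEOREM from the
PRINTED fact `Literature.NumberTheory.EllipticCurves.Disegni2020.padicBSD_goodOrd_rankOne` (Disegni, Kyoto J. Math. 60 (2020) Thm. 1 = Thm. 4 (i),
every ordinary p, p = 2 INCLUDED; typer p606485, placement REF2 v17 §1 (A)):** `…Theorems.AlignedTransportAtTwoDisegni.perrinRiouComparisonAtTwo_of_disegni`
(p609883, exact form `…_exact_of_disegni`, witness `q = #Ш_an·∏c_v/tors²`). The new registered stub `stub_disegniAtTwo` is that PRINT fact BY NAME. Moreover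
(same file, §2–§3): on the cell the simple-zero binder makes Schneider's non-degeneracy `Reg₂ ≠ 0` an OUTPUT (`schneiderConjecture_of_disegni_of_order_eq_one`),
and of T-23008-a ONLY CONJUNCT (3) — the bare leading-term FORMULA for a characteristic generator, given `Reg₂ ≠ 0` and `Ш[2^∞]` finite — is load-bearing
(`bsdOfMainConjectureRankOneAtTwo_of_leadingTermFormulaAtTwo_of_disegni`); conjuncts (1) `rank ≤ ord_T f_E` and (2) `ord_T f_E = rank ↔ …` are idle.
**v4 (this file): the open stub is REGISTERED IN ITS WEAKEST FORM — `stub_leadingTermFormulaAtTwo` = conjunct (3) ALONE, inline (body = hypothesis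
`ha3` of that closure verbatim; implied by `SchneiderLeadingTermAtTwoSq` by projection; typer asked to file it by name as
`F1Sign2.SchneiderLeadingTermFormulaAtTwoSq`)** and it is TIGHT: per cell curve, modulo the four PRINT facts and the crux binders, (3) ⟺ `BSDp W 2`
(`…Theorems.AlignedTransportAtTwoDisegniTight.leadingTermFormulaAtTwoAt_iff_bsdp`, p611969).
Registered stubs (5 ≤ stubs_max; v6: 4 carry `sorry`): M `stub_modularityAtTwo`, `stub_gzkAtTwo`, `stub_disegniAtTwo` (PRINT named facts), `stub_sigmaSqTwo`
(PRINT, CLOSED v6) + `stub_leadingTermFormulaAtTwo` (the ONE OPEN statement, by name = T-23008-a (3)). Stub O (att-p3's order transfer, landed) stays as the PROVED rung.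
Composition `BSDOfMainConjectureRankOneAtTwo_of` = `…AlignedTransportAtTwoDisegni.bsdOfMainConjectureRankOneAtTwo_of_leadingTermFormulaAtTwo_of_disegni` (p609883), concludes the crux BY NAME.
HONEST FRAMING: BSD is not proved; C3′ stays OPEN modulo exactly ONE statement not in print at 2 (Schneider 1985 Thm 2′ / BMS Thm 1.7 (3) read at p = 2
over the Σ² receptacle) and four published facts; every `stub_*` is `sorry`. -/

set_option linter.dupNamespace false

noncomputable section

namespace Summit.BirchSwinnertonDyer.BirchSwinnertonDyer.Cruxes.BSDOfMainConjectureRankOneAtTwo.Birth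

open Summit.BirchSwinnertonDyer.BirchSwinnertonDyer.Theses.AlignedTransportAtTwo
open WeierstrassCurve Literature.NumberTheory.EllipticCurves Literature.NumberTheory.EllipticCurves.ModularForms CongruenceSubgroup
  Literature.NumberTheory.EllipticCurves.Greenberg1999 Summit.BirchSwinnertonDyer.Rank1Residual.F1Sign2
  Summit.BirchSwinnertonDyer.BirchSwinnertonDyer.Theorems.Rank1ResidualX1Defs

/-- ALGEBRAIC SIMPLE ZERO at `2` (the typed intermediate, planner v3 VERBATIM): on the cell, with `ord_T L₂(f_E) = 1` and
the main conjecture, every cyclotomic Selmer-dual datum is torsion and has a characteristic generator with a SIMPLE zero at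
`T = 0`. Nothing asserted. -/
def AlgebraicSimpleZeroAtTwo : Prop :=
  ∀ (W : WeierstrassCurve ℚ) [W.IsElliptic] [W.IsGloballyMinimal],
    ¬ W.HasCM → IsOrdinaryAt W 2 → (∀ x : ℚ, ¬ Greenberg1999.HasRationalTwoTorsionX W x) → ¬ IsSquare W.Δ →
    W.analyticRank = 1 →
    (∀ [NeZero (W.conductorNorm ℤ)] (f : CuspForm (Gamma0 (W.conductorNorm ℤ)) 2), IsNewformOf W f →
        (padicLFunction f (unitRoot W 2 : ℚ_[2])).order = 1) →
    MazurMainConjecture W 2 →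
    ∀ (κ : ZpExtension ℚ 2) (γ : Field.absoluteGaloisGroup ℚ),
      κ.IsCyclotomic → κ.IsTopGenerator γ → IsCyclotomicVariable 2 γ →
    ∀ (D : W.SelmerDualData κ γ), D.IsTorsion ∧ ∃ g : IwasawaAlgebra 2, D.charIdeal = Ideal.span {g} ∧ g.order = 1



/-- stub M — PRINT: modularity in the parametrisation currency (`nonempty_modularParametrizationData`, BCDT 2001 Thm A + Edixhoven). -/
theorem stub_modularityAtTwo : nonempty_modularParametrizationData := by
  sorry

/-- stub O — ORDER TRANSFER (size M): CLOSED, no sorry — `Theorems.AlignedTransportAtTwoOrderTransfer.algebraicSimpleZeroAtTwo_of_modularity`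
(p591537): `ι g = ϖ · L₂(f_E, α)` with `ϖ > 0` from the parametrisation datum and `ord_T L₂ = 1` give `ord_T g = 1`. -/
theorem stub_orderTransferAtTwo : nonempty_modularParametrizationData → AlgebraicSimpleZeroAtTwo :=
  fun hmod => Summit.BirchSwinnertonDyer.BirchSwinnertonDyer.Theorems.AlignedTransportAtTwoOrderTransfer.algebraicSimpleZeroAtTwo_of_modularity hmod

/-- stub L0a — PRINT: Gross–Zagier–Kolyvagin, `r_an ≤ 1 ⇒ rank = r_an ∧ Ш finite` (`rank_eq_analyticRank_of_analyticRank_le_one`).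
[cite: GrossZagier1986] [cite: Kolyvagin1990] -/
theorem stub_gzkAtTwo : rank_eq_analyticRank_of_analyticRank_le_one := by
  sorry

/-- stub L0b — PRINT, **CLOSED (v6), no sorry**: the Mazur–Tate sigma-squared division series at `2` (`mazurTate_sigmaSq_existsUnique_two`;
Mazur–Tate 1991 Thm 3.1 / Silverman 2005 §5 Rem 2) — inhabits the `2`-adic height receptacle `IsCanonicalSq` at a good ordinary `2`. DISCHARGED by
att-p3 g8/g9: `…Theorems.AlignedTransportAtTwoSigmaSqTwo.mazurTate_sigmaSq_existsUnique_two_holds` (p644698). [cite: MazurTate1991, Thm. 3.1]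
[cite: Silverman2005DivPoly, §5 Rem. 2] [cite: BlakestadGrant2023, Thm. 1] -/
theorem stub_sigmaSqTwo : mazurTate_sigmaSq_existsUnique_two :=
  Summit.BirchSwinnertonDyer.BirchSwinnertonDyer.Theorems.AlignedTransportAtTwoSigmaSqTwo.mazurTate_sigmaSq_existsUnique_two_holds

/-- stub L1′ — THE ONE OPEN statement at `2`, in its WEAKEST form, now BY NAME (v5): `F1Sign2.SchneiderLeadingTermFormulaAtTwoSq`
(tree, p612167) = conjunct (3) ALONE of `F1Sign2.SchneiderLeadingTermAtTwoSq` (T-23008-a; Schneider 1985 Thm 2′ / BMS 2016 Thm 1.7 (3)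
read at `p = 2` over the `Σ²` receptacle): for `W` good ordinary at `2`, every cyclotomic datum, every torsion Selmer dual with characteristic
generator `f_E`, THE canonical `Dh`, IF `Reg₂(Dh) ≠ 0` and `Ш[2^∞]` is finite THEN
`[T^r]f_E · (log₂ γ)^r · tors² = u · (1 − α⁻¹)² · #Ш[2^∞] · Reg₂(Dh) · ∏ c_v`, `u ∈ ℤ₂ˣ`. Its body is the hypothesis `ha3` of
`…AlignedTransportAtTwoDisegni.bsdOfMainConjectureRankOneAtTwo_of_leadingTermFormulaAtTwo_of_disegni` VERBATIM (v4 carried it inline);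
implied by the named T-23008-a (`F1Sign2.schneiderLeadingTermFormulaAtTwoSq_of_schneiderLeadingTermAtTwoSq`); TIGHT per cell curve
(`…AlignedTransportAtTwoDisegniTight.leadingTermFormulaAtTwoAt_iff_bsdp`). NOT in print at `2` (file docstring of the named decl: BMS 1.7 (3)
`p > 2`, Schneider 1985 `p` odd, Perrin-Riou 1992 `p` odd, Greenberg LNM 1716 p. 91 `p` odd; rank-0 slice = Greenberg Thm 4.1, every `p`).
[cite: BalakrishnanMullerStein2015, Thm. 1.7 (3) (printed for p > 2; the p = 2 text is ours)] [cite: Schneider1985, Thm. 2′ (hypotheses at p = 2 unverified)] -/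
theorem stub_leadingTermFormulaAtTwo : Summit.BirchSwinnertonDyer.Rank1Residual.F1Sign2.SchneiderLeadingTermFormulaAtTwoSq := by
  sorry

/-- stub D — PRINT: Disegni 2020 Thm. 1 = Thm. 4 (i) — the `p`-adic BSD leading term WITH `#Ш_an` at a good ordinary prime in analytic rank one,
EVERY ordinary `p`, `p = 2` included (`Disegni2020.padicBSD_goodOrd_rankOne`, typer p606485). It REPLACES v2's open stub L2: `PerrinRiouComparisonAtTwo`
follows from it (`…Theorems.AlignedTransportAtTwoDisegni.perrinRiouComparisonAtTwo_of_disegni`, p609883). [cite: Disegni2020, Thm. 1 (§1.2) = Thm. 4 first bullet (§3.2), Prop. 2] -/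
theorem stub_disegniAtTwo : Disegni2020.padicBSD_goodOrd_rankOne := by
  sorry

/-- Composition (kernel-checked, closed): the crux BY NAME from the five registered stubs through the landed closure (p609883 §3). -/
theorem BSDOfMainConjectureRankOneAtTwo_of : BSDOfMainConjectureRankOneAtTwo :=
  Summit.BirchSwinnertonDyer.BirchSwinnertonDyer.Theorems.AlignedTransportAtTwoDisegni.bsdOfMainConjectureRankOneAtTwo_of_leadingTermFormulaAtTwo_of_disegni
    stub_leadingTermFormulaAtTwo stub_disegniAtTwo stub_gzkAtTwo stub_modularityAtTwo stub_sigmaSqTwo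

end Summit.BirchSwinnertonDyer.BirchSwinnertonDyer.Cruxes.BSDOfMainConjectureRankOneAtTwo.Birth

end
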